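import Summits.Langlands.Langlands.Theorems.RationalPeriodQuarterAnalyticCoreMobius

/-!
# `AnalyticCore` (child 2 of the lens-1-g38 split of `RationalPeriodQuarter.SemiAnalyticRigidity`) — the coordinate at infinity

Toolkit for the coordinate `u = (N t + 1)⁻¹` at `∞`: the maps `τ u = (1 - u)/(N u)` (back to `t`),
`σ u = u/(1 + N u)` (the translation `t ↦ t + 1` read in `u`), their identities, signs and limits
(`τ → ±∞` as `u → 0±`, `σ → 0±`, `u(t) → 0±` as `t → ±∞`), transfer of cofinite-in-`t` statements to
punctured neighbourhoods of `u = 0`, a three-term fraction combination, and extraction of intervals from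
one-sided eventual statements.
-/

set_option linter.dupNamespace false

namespace Summit.Langlands.Langlands.Theorems

open Filter Set Topology Polynomial

/-- Three fractions `P₁/Q₁ - P₂/Q₂ + P₃/Q₃` as one. -/
theorem anCore_three_fractions (P₁ Q₁ P₂ Q₂ P₃ Q₃ : ℂ[X]) :
    ∃ Pc Qc : ℂ[X], ∀ z : ℂ, Q₁.eval z ≠ 0 → Q₂.eval z ≠ 0 → Q₃.eval z ≠ 0 →
      Qc.eval z ≠ 0 ∧ P₁.eval z / Q₁.eval z - P₂.eval z / Q₂.eval z + P₃.eval z / Q₃.eval z =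
        Pc.eval z / Qc.eval z := by
  refine ⟨P₁ * Q₂ * Q₃ - P₂ * Q₁ * Q₃ + P₃ * Q₁ * Q₂, Q₁ * Q₂ * Q₃, fun z h1 h2 h3 => ?_⟩
  simp only [Polynomial.eval_mul, Polynomial.eval_add, Polynomial.eval_sub]
  refine ⟨mul_ne_zero (mul_ne_zero h1 h2) h3, ?_⟩
  field_simp

/-- `τ (σ u) = τ u + 1` and `σ u ≠ 0`. -/
theorem anCore_sigma_identities (N : ℕ) (hN : 0 < N) (u : ℝ) (hu : u ≠ 0) (h1 : 1 + (N : ℝ) * u ≠ 0) :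
    (1 - u / (1 + (N : ℝ) * u)) / ((N : ℝ) * (u / (1 + (N : ℝ) * u))) = (1 - u) / ((N : ℝ) * u) + 1 ∧
      u / (1 + (N : ℝ) * u) ≠ 0 := by
  have hN' : (N : ℝ) ≠ 0 := by exact_mod_cast hN.ne'
  have h1' : 1 + u * (N : ℝ) ≠ 0 := by rwa [mul_comm] at h1
  refine ⟨?_, div_ne_zero hu h1⟩
  rw [div_add_one (mul_ne_zero hN' hu), div_eq_div_iff (mul_ne_zero hN' (div_ne_zero hu h1))
    (mul_ne_zero hN' hu)]
  field_simp
  ring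

/-- `τ (u t) = t` and `u (t + 1) = σ (u t)` for `u t = (N t + 1)⁻¹`. -/
theorem anCore_ut_identities (N : ℕ) (hN : 0 < N) (t : ℝ) (h1 : (N : ℝ) * t + 1 ≠ 0) :
    (1 - ((N : ℝ) * t + 1)⁻¹) / ((N : ℝ) * ((N : ℝ) * t + 1)⁻¹) = t ∧
      ((N : ℝ) * (t + 1) + 1)⁻¹ = ((N : ℝ) * t + 1)⁻¹ / (1 + (N : ℝ) * ((N : ℝ) * t + 1)⁻¹) ∧
      ((N : ℝ) * t + 1)⁻¹ ≠ 0 := by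
  have hN' : (N : ℝ) ≠ 0 := by exact_mod_cast hN.ne'
  refine ⟨?_, ?_, inv_ne_zero h1⟩
  · field_simp; ring
  · have h3 : 1 + (N : ℝ) * ((N : ℝ) * t + 1)⁻¹ = ((N : ℝ) * (t + 1) + 1) / ((N : ℝ) * t + 1) := by
      field_simp; ring
    rw [h3, div_div_eq_mul_div, inv_mul_cancel₀ h1, one_div]

/-- `τ u > R` for `0 < u < 1/(1 + N R)` (`R ≥ 0`). -/
theorem anCore_tau_gt (N : ℕ) (hN : 0 < N) (R : ℝ) (hR : 0 ≤ R) (u : ℝ) (hu0 : 0 < u)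
    (hu : u < 1 / (1 + N * R)) : R < (1 - u) / ((N : ℝ) * u) := by
  have hN' : (0 : ℝ) < N := by exact_mod_cast hN
  rw [lt_div_iff₀ (by positivity)]
  have : u * (1 + N * R) < 1 := by
    calc u * (1 + N * R) < 1 / (1 + N * R) * (1 + N * R) := by gcongr
      _ = 1 := by field_simp
  nlinarith

/-- `τ u < -R` for `-1/(1 + N R) < u < 0` (`R ≥ 0`). -/
theorem anCore_tau_lt (N : ℕ) (hN : 0 < N) (R : ℝ) (hR : 0 ≤ R) (u : ℝ) (hu0 : u < 0)
    (hu : -(1 / (1 + N * R)) < u) : (1 - u) / ((N : ℝ) * u) < -R := by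
  have hN' : (0 : ℝ) < N := by exact_mod_cast hN
  rw [div_lt_iff_of_neg (by nlinarith)]
  have h1 : -(u * (N * R)) ≤ N * R / (1 + N * R) := by
    have hle : -u ≤ 1 / (1 + N * R) := by linarith
    have h2 : -(u * (N * R)) = (-u) * (N * R) := by ring
    rw [h2]
    calc (-u) * (N * R) ≤ 1 / (1 + N * R) * (N * R) :=
          mul_le_mul_of_nonneg_right hle (mul_nonneg hN'.le hR)
      _ = N * R / (1 + N * R) := by ring
  have h3 : N * R / (1 + N * R) < 1 := by
    rw [div_lt_one (by positivity)]; linarith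
  nlinarith

/-- A cofinite real statement holds on both tails. -/
theorem anCore_cofinite_tails {p : ℝ → Prop} (h : ∀ᶠ t in Filter.cofinite, p t) :
    ∃ R : ℝ, 0 ≤ R ∧ ∀ t : ℝ, (R < t ∨ t < -R) → p t := by
  rw [Filter.eventually_cofinite] at h
  obtain ⟨M₁, hM₁⟩ := h.bddAbove
  obtain ⟨M₂, hM₂⟩ := h.bddBelow
  refine ⟨max (max M₁ (-M₂)) 0, le_max_right _ _, fun t ht => ?_⟩
  by_contra hp
  have h1 : t ≤ M₁ := hM₁ hp
  have h2 : M₂ ≤ t := hM₂ hp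
  rcases ht with ht | ht
  · have := le_trans (le_max_left M₁ (-M₂)) (le_max_left _ (0 : ℝ)); linarith
  · have := le_trans (le_max_right M₁ (-M₂)) (le_max_left _ (0 : ℝ)); linarith

/-- Transfer: a cofinite statement in `t` holds at `τ u` for all small `u > 0`. -/
theorem anCore_transfer_right (N : ℕ) (hN : 0 < N) {p : ℝ → Prop} (h : ∀ᶠ t in Filter.cofinite, p t) :
    ∃ δ : ℝ, 0 < δ ∧ ∀ u : ℝ, 0 < u → u < δ → p ((1 - u) / ((N : ℝ) * u)) := by
  obtain ⟨R, hR, hp⟩ := anCore_cofinite_tails h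
  exact ⟨1 / (1 + N * R), by positivity, fun u hu0 hu => hp _ (Or.inl (anCore_tau_gt N hN R hR u hu0 hu))⟩

/-- Transfer: a cofinite statement in `t` holds at `τ u` for all small `u < 0`. -/
theorem anCore_transfer_left (N : ℕ) (hN : 0 < N) {p : ℝ → Prop} (h : ∀ᶠ t in Filter.cofinite, p t) :
    ∃ δ : ℝ, 0 < δ ∧ ∀ u : ℝ, u < 0 → -δ < u → p ((1 - u) / ((N : ℝ) * u)) := by
  obtain ⟨R, hR, hp⟩ := anCore_cofinite_tails h
  exact ⟨1 / (1 + N * R), by positivity, fun u hu0 hu => hp _ (Or.inr (anCore_tau_lt N hN R hR u hu0 hu))⟩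

/-- A nonzero polynomial does not vanish at the nonzero points of a small interval around `0`. -/
theorem anCore_poly_punctured (Q : ℂ[X]) (hQ : Q ≠ 0) :
    ∃ ζ : ℝ, 0 < ζ ∧ ∀ v : ℝ, v ≠ 0 → |v| < ζ → Q.eval (v : ℂ) ≠ 0 := by
  have hev := tameDecomp_eventually_nhdsNE_of_cofinite (tameDecomp_eventually_cofinite_eval_ne_zero hQ) 0
  obtain ⟨ζ, hζ, hball⟩ := Metric.eventually_nhds_iff.1 (eventually_nhdsWithin_iff.1 hev)
  refine ⟨ζ, hζ, fun v hv hvζ => hball (by simpa [Real.dist_eq] using hvζ) hv⟩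

/-- `σ` keeps small positive numbers small and positive: `0 < σ u ≤ u`. -/
theorem anCore_sigma_pos (N : ℕ) (u : ℝ) (hu : 0 < u) :
    0 < u / (1 + (N : ℝ) * u) ∧ u / (1 + (N : ℝ) * u) ≤ u := by
  have h1 : (1 : ℝ) ≤ 1 + (N : ℝ) * u := by
    have : (0 : ℝ) ≤ (N : ℝ) * u := by positivity
    linarith
  refine ⟨div_pos hu (by linarith), ?_⟩
  rw [div_le_iff₀ (by linarith)]
  nlinarith

/-- `σ` keeps small negative numbers negative with `|σ u| ≤ 2 |u|` when `|u| ≤ 1/(2N)`. -/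
theorem anCore_sigma_neg (N : ℕ) (hN : 0 < N) (u : ℝ) (hu : u < 0) (hsmall : -(1 / (2 * (N : ℝ))) ≤ u) :
    u / (1 + (N : ℝ) * u) < 0 ∧ 2 * u ≤ u / (1 + (N : ℝ) * u) := by
  have hN' : (0 : ℝ) < N := by exact_mod_cast hN
  have h1 : (1 : ℝ) / 2 ≤ 1 + (N : ℝ) * u := by
    have : (N : ℝ) * (-(1 / (2 * (N : ℝ)))) ≤ (N : ℝ) * u := by gcongr
    have h2 : (N : ℝ) * (-(1 / (2 * (N : ℝ)))) = -(1 / 2) := by field_simp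
    linarith
  refine ⟨div_neg_of_neg_of_pos hu (by linarith), ?_⟩
  rw [le_div_iff₀ (by linarith)]
  nlinarith

/-- From a right-eventual statement at `0` to an interval `(0, δ)`. -/
theorem anCore_Ioo_of_nhdsGT {p : ℝ → Prop} (h : ∀ᶠ (u : ℝ) in 𝓝[>] 0, p u) :
    ∃ δ : ℝ, 0 < δ ∧ ∀ u : ℝ, 0 < u → u < δ → p u := by
  obtain ⟨b, hb, hsub⟩ := mem_nhdsGT_iff_exists_Ioo_subset.1 h
  exact ⟨b, hb, fun u hu0 hub => hsub ⟨hu0, hub⟩⟩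

/-- From a left-eventual statement at `0` to an interval `(-δ, 0)`. -/
theorem anCore_Ioo_of_nhdsLT {p : ℝ → Prop} (h : ∀ᶠ (u : ℝ) in 𝓝[<] 0, p u) :
    ∃ δ : ℝ, 0 < δ ∧ ∀ u : ℝ, u < 0 → -δ < u → p u := by
  obtain ⟨a, ha, hsub⟩ := mem_nhdsLT_iff_exists_Ioo_subset.1 h
  have ha' : a < 0 := ha
  exact ⟨-a, by linarith, fun u hu0 hua => hsub ⟨by linarith, hu0⟩⟩

/-- `u(t) = (N t + 1)⁻¹` is small and positive for all large `t`, small and negative for all very negative `t`,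
quantitatively. -/
theorem anCore_ut_small (N : ℕ) (hN : 0 < N) (δ : ℝ) (hδ : 0 < δ) :
    (∀ t : ℝ, 1 / δ / N < t → 0 < ((N : ℝ) * t + 1)⁻¹ ∧ ((N : ℝ) * t + 1)⁻¹ < δ) ∧
      (∀ t : ℝ, t < -((1 / δ + 1) / N) → ((N : ℝ) * t + 1)⁻¹ < 0 ∧ -δ < ((N : ℝ) * t + 1)⁻¹) := by
  have hN' : (0 : ℝ) < N := by exact_mod_cast hN
  constructor
  · intro t ht
    have h1 : 1 / δ < (N : ℝ) * t := by rwa [div_lt_iff₀ hN', mul_comm] at ht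
    have h2 : 0 < (N : ℝ) * t + 1 := by have := one_div_pos.2 hδ; linarith
    refine ⟨inv_pos.2 h2, ?_⟩
    rw [inv_lt_comm₀ h2 hδ]
    rw [one_div] at h1; linarith
  · intro t ht
    have h1 : (N : ℝ) * t < -(1 / δ + 1) := by
      rw [← neg_div] at ht
      have := (lt_div_iff₀ hN').1 ht
      rw [mul_comm] at this
      exact this
    have h2 : (N : ℝ) * t + 1 < -(1 / δ) := by linarith
    have h3 : (N : ℝ) * t + 1 < 0 := by have := one_div_pos.2 hδ; linarith
    refine ⟨inv_lt_zero.2 h3, ?_⟩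
    have h4 : 1 / δ < -((N : ℝ) * t + 1) := by linarith
    have h5 : (-((N : ℝ) * t + 1))⁻¹ < δ := by
      rw [inv_lt_comm₀ (by linarith) hδ]; rw [one_div] at h4; exact h4
    rw [inv_neg] at h5
    linarith

end Summit.Langlands.Langlands.Theorems
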